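import Literature.Probability.RandomPlanarGeometry.HexSAWEndpointSymmetry
import Literature.Probability.RandomPlanarGeometry.HexSAWBrickWallBridgeKesten
import HarnessLib

/-!
# The polygon lower envelope on `ℍ` from a bridge-pair bound, and the unconditional shape of the polygon two-step ratio
# («HEX-ENDPOINT-RATIO-2», file F4: the interface with the lane's HEX-SAP line)

Topic `Literature/Probability/RandomPlanarGeometry` (lane «pcv-sawmu»; continues `HexSAWEndpointSymmetry.lean` — `HV.endFin`,
`rot3`, `nb0 nb1 nb2`, `adjEndFin`, `HexEndpointLo`, `HexAdjEndLo`, `hexPolygonRatioTwo_of`, `hexAdjEndRatioTwo_of` — and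
`HexSAWBrickWallBridgeKesten.lean` — the all-length bridge envelope `HV.hexBridgeLo : e^{-9√n} μ_ℍ^n ≤ b_n(ℍ)` in the brick-wall
frame `HexBW.bridgeCount`).

Source: N. Madras, G. Slade, *The Self-Avoiding Walk* (1993), Theorem 3.2.3 / (3.2.5) p. 65 and Theorem 3.2.4 p. 66 (the polygon
lower bound `p_n ≥ b_m²/poly`, by gluing two bridges), Corollary 3.2.5–3.2.6 pp. 67–68 (`c_N(0,x)^{1/N} → μ`), Theorem 7.3.4 (b),(c)
p. 248. On the honeycomb lattice the bridge-pair bound is the lane's HEX-SAP theorem (brick-wall frame, a-p6 g6: for `K ≥ 1`,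
`b_{2K}(ℍ)² ≤ P(K) · #{ρ ∈ HexBW.saws (4K+21) : ρ(4K+21) = e₀}` and the same at `4K+23`, `e₀ = (1,0)`, `P` a polynomial) — taken
here as the displayed hypothesis schema `HexSAPPairBound P` (ℕ-valued, that shape verbatim), to be discharged BY NAME when that
file is in the tree. THIS FILE proves: (i) the brick-wall form of the fixed-endpoint count, `#E_N(z) = #{ρ ∈ HexBW.saws N : ρ N =
hvToBW z}` (`card_endFin_eq_card_bw`), with `hvToBW nb2 = e₀`; (ii) `HexSAPPairBound P` with `P(K) ≤ d·K^k` and the bridge envelope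
give the endpoint envelope `HexEndpointLo z (log d + 2k + 30) 1` for EACH neighbour `z` of the origin (the third neighbour by the
rotation `rot3`) and the polygon envelope `HexAdjEndLo (log d + 2k + 30)`; (iii) hence the polygon two-step ratios
`#E_{2m+3}(z)/#E_{2m+1}(z) → 2 + √2` and `#A_{2m+3}/#A_{2m+1} → 2 + √2` with NO envelope hypothesis left — conditional only on
`HexSAPPairBound P` (Madras–Slade Theorem 7.3.4 (c) on `ℍ` modulo the HEX-SAP pair bound).

## Contents (namespace `Literature.Probability.RandomPlanarGeometry.SAW.HV`; all PROVED, axioms standard)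

* `card_endFin_eq_card_bw`, `hvToBW_nb2`; `HexSAPPairBound P` (schema); `hexEndpointLo_congr`;
* `pairBound_core` (the arithmetic: `e^{-(p+30)√N} μ^N ≤ e` from `b² ≤ P e`, `e^{-9√(2K)}μ^{2K} ≤ b`, `P ≤ e^{p√K}`, `4K+21 ≤ N ≤ 4K+23`);
* **`hexEndpointLo_nb2_of_pairBound`**, **`hexEndpointLo_of_pairBound`** (every neighbour), **`hexAdjEndLo_of_pairBound`**;
* **`hexPolygonRatioTwo_of_pairBound`**, **`hexAdjEndRatioTwo_of_pairBound`**.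
-/

noncomputable section

open Finset Filter Topology Literature.Probability.LatticeModels SimpleGraph
open scoped BigOperators

namespace Literature.Probability.RandomPlanarGeometry.SAW.HV

/-! ### The brick-wall form of the fixed-endpoint count -/

section BW

/-- **`#E_N(z) = #{ρ ∈ HexBW.saws N : ρ N = hvToBW z}`** (the lane's HEX-SAP count `HexBW.endAtCount N (hvToBW z)` is this right-hand
side), by the transport `toBW`. [cite: EntingJensen2009, §7.4.2, Fig. 7.10 (brick-wall form of the hexagonal lattice)] -/
theorem card_endFin_eq_card_bw (z : HV) (N : ℕ) :
    #(endFin z N) = #((HexBW.saws N).filter fun ρ => ρ N = hvToBW z) := by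
  classical
  have himage : (endFin z N).image (toBW N) = (HexBW.saws N).filter fun ρ => ρ N = hvToBW z := by
    ext f
    rw [Finset.mem_image, Finset.mem_filter]
    simp only [mem_endFin]
    constructor
    · rintro ⟨ω, ⟨hω, hz⟩, rfl⟩
      exact ⟨toBW_mem_saws hω, by rw [toBW_apply, min_self, hz]⟩
    · rintro ⟨hf, hz⟩
      have hf' : f ∈ HexBW.ofList N '' sawLists brickWallGraph (0 : Site 2) N := by
        rw [HexBW.ofList_image]; exact Finset.mem_coe.2 hf
      obtain ⟨l, hl, rfl⟩ := hf'
      set ω : List HV := l.map bwToHV with hωdef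
      have hωl : ω.map hvToBW = l := by
        rw [hωdef, List.map_map]
        convert List.map_id l
        funext x
        exact hvToBW_bwToHV x
      have hω : ω ∈ sawFin hvOrigin N := by
        rw [mem_sawFin_iff]
        have h := (map_mem_sawLists_iff bwIso (v := (0 : Site 2)) (n := N) (l := l)).2 hl
        have e : (⇑bwIso : Site 2 → HV) = bwToHV := funext bwIso_apply
        rwa [e, bwToHV_zero] at h
      have htoBW : toBW N ω = HexBW.ofList N l := by rw [toBW, hωl]
      refine ⟨ω, ⟨hω, ?_⟩, htoBW⟩
      rw [← htoBW, toBW_apply, min_self] at hz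
      -- `hvToBW` is injective
      have := congrArg bwToHV hz
      rwa [bwToHV_hvToBW, bwToHV_hvToBW] at this
  have hinj : Set.InjOn (toBW N) ↑(endFin z N) :=
    (toBW_injOn N).mono fun ω hω => Finset.mem_coe.2 (mem_endFin.1 (Finset.mem_coe.1 hω)).1
  rw [← himage, Finset.card_image_of_injOn hinj]

/-- `hvToBW nb2 = e₀ = (1, 0)` (the brick-wall horizontal neighbour of the origin). [cite: EntingJensen2009, §7.4.2, Fig. 7.10 (brick-wall form of the hexagonal lattice)] -/
theorem hvToBW_nb2 : hvToBW nb2 = Pi.single 0 1 := by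
  rw [site_two_eq_iff, hvToBW_apply_zero, hvToBW_apply_one]
  simp [nb2]

end BW

/-! ### The HEX-SAP pair bound (hypothesis schema) and the envelope it yields -/

section PairBound

/-- **The HEX-SAP bridge-pair bound** (hypothesis schema, the lane's a-p6 face shape in the brick-wall frame): for `K ≥ 1`,
`b_{2K}(ℍ)² ≤ P(K) · #{ρ ∈ HexBW.saws (4K+21) : ρ(4K+21) = (1,0)}` and the same at length `4K+23` (two bridges of length `2K` glued,
with connectors, into a rooted polygon through the edge `{0, (1,0)}`, both residues mod 4).
[cite: MadrasSlade1993, Theorem 3.2.4 p. 66 (p ≥ b²/poly by gluing two bridges)] -/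
def HexSAPPairBound (P : ℕ → ℕ) : Prop :=
  ∀ K : ℕ, 1 ≤ K →
    HexBW.bridgeCount (2 * K) ^ 2 ≤ P K * #((HexBW.saws (4 * K + 21)).filter fun ρ => ρ (4 * K + 21) = Pi.single 0 1) ∧
    HexBW.bridgeCount (2 * K) ^ 2 ≤ P K * #((HexBW.saws (4 * K + 23)).filter fun ρ => ρ (4 * K + 23) = Pi.single 0 1)

/-- The envelope schema depends on `z` only through the counts `#E_N(z)`. [cite: MadrasSlade1993, Corollary 3.2.6 (3.2.10), p. 68] -/
theorem hexEndpointLo_congr {z z' : HV} {c : ℝ} {δ : ℕ} (h : ∀ N, #(endFin z' N) = #(endFin z N))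
    (hLo : HexEndpointLo z c δ) : HexEndpointLo z' c δ := by
  obtain ⟨m₀, hm₀⟩ := hLo
  exact ⟨m₀, fun m hm => by rw [h]; exact hm₀ m hm⟩

/-- `18 √(2K) ≤ 26 √K`. [folklore] -/
private theorem eighteen_sqrt_two_mul_le (K : ℝ) (hK : 0 ≤ K) : 18 * Real.sqrt (2 * K) ≤ 26 * Real.sqrt K := by
  have h1 : 18 * Real.sqrt (2 * K) = Real.sqrt (648 * K) := by
    rw [show (648 : ℝ) * K = 18 ^ 2 * (2 * K) by ring, Real.sqrt_mul (by norm_num) (2 * K), Real.sqrt_sq (by norm_num)]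
  have h2 : 26 * Real.sqrt K = Real.sqrt (676 * K) := by
    rw [show (676 : ℝ) * K = 26 ^ 2 * K by ring, Real.sqrt_mul (by norm_num) K, Real.sqrt_sq (by norm_num)]
  rw [h1, h2]
  exact Real.sqrt_le_sqrt (by nlinarith)

/-- `μ_ℍ^j ≤ e^{23}` for `j ≤ 23` (`μ_ℍ ≤ 37/20 ≤ e`). [cite: DuminilCopinSmirnov2012, Theorem 1] -/
private theorem hexMu_pow_le_exp {j : ℕ} (hj : j ≤ 23) : hexConnectiveConstant ^ j ≤ Real.exp 23 := by
  have hμ1 : 1 ≤ hexConnectiveConstant := one_le_hexConnectiveConstant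
  have hμe : hexConnectiveConstant ≤ Real.exp 1 := by
    have h := hexConnectiveConstant_le.1
    have h2 : (2 : ℝ) ≤ Real.exp 1 := by have := Real.add_one_le_exp (1 : ℝ); linarith
    linarith
  calc hexConnectiveConstant ^ j ≤ hexConnectiveConstant ^ 23 := pow_le_pow_right₀ hμ1 hj
    _ ≤ Real.exp 1 ^ 23 := pow_le_pow_left₀ (by linarith) hμe 23
    _ = Real.exp 23 := by rw [← Real.exp_nat_mul]; norm_num

/-- **The arithmetic core**: from `b² ≤ P·e`, the bridge envelope `e^{-9√(2K)} μ^{2K} ≤ b`, `P ≤ e^{p√K}` (`p ≥ 0`, `K ≥ 1`) and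
`4K+21 ≤ N ≤ 4K+23` one gets `e^{-(p+30)√N} μ^N ≤ e`. [cite: MadrasSlade1993, Theorem 3.2.4 and Corollary 3.2.6 (the arithmetic)] -/
theorem pairBound_core {b e P p : ℝ} {K N : ℕ} (hK : 1 ≤ K) (hp : 0 ≤ p) (hN1 : 4 * K + 21 ≤ N) (hN2 : N ≤ 4 * K + 23)
    (hb : Real.exp (-(9 * Real.sqrt ((2 * K : ℕ) : ℝ))) * hexConnectiveConstant ^ (2 * K) ≤ b)
    (hP0 : 0 < P) (hP : P ≤ Real.exp (p * Real.sqrt (K : ℝ))) (h : b ^ 2 ≤ P * e) :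
    Real.exp (-((p + 30) * Real.sqrt (N : ℝ))) * hexConnectiveConstant ^ N ≤ e := by
  have hμ := hexConnectiveConstant_pos
  have hKr : (1 : ℝ) ≤ K := by exact_mod_cast hK
  have hsK : 1 ≤ Real.sqrt (K : ℝ) := by
    rw [Real.le_sqrt (by norm_num) (by positivity)]; simpa using hKr
  -- `√N ≥ 2 √K`
  have hNr : (4 : ℝ) * K ≤ N := by exact_mod_cast (show 4 * K ≤ N by omega)
  have hsN : 2 * Real.sqrt (K : ℝ) ≤ Real.sqrt (N : ℝ) := by
    rw [show (2 : ℝ) * Real.sqrt K = Real.sqrt (4 * K) by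
      rw [show (4 : ℝ) * K = 2 ^ 2 * K by ring, Real.sqrt_mul (by norm_num) (K : ℝ), Real.sqrt_sq (by norm_num)]]
    exact Real.sqrt_le_sqrt hNr
  -- lower bound for `e`: `e ≥ b²/P ≥ e^{-18√(2K) - p√K} μ^{4K}`
  have hb0 : 0 ≤ Real.exp (-(9 * Real.sqrt ((2 * K : ℕ) : ℝ))) * hexConnectiveConstant ^ (2 * K) := by positivity
  have hb2 : (Real.exp (-(9 * Real.sqrt ((2 * K : ℕ) : ℝ))) * hexConnectiveConstant ^ (2 * K)) ^ 2 ≤ b ^ 2 :=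
    pow_le_pow_left₀ hb0 hb 2
  have he : (Real.exp (-(9 * Real.sqrt ((2 * K : ℕ) : ℝ))) * hexConnectiveConstant ^ (2 * K)) ^ 2 ≤
      Real.exp (p * Real.sqrt (K : ℝ)) * e := by
    have h1 : b ^ 2 ≤ Real.exp (p * Real.sqrt (K : ℝ)) * e := by
      rcases le_or_gt 0 e with he0 | he0
      · exact h.trans (mul_le_mul_of_nonneg_right hP he0)
      · have : P * e < 0 := mul_neg_of_pos_of_neg hP0 he0
        nlinarith [sq_nonneg b]
    exact hb2.trans h1
  -- rewrite the square
  have hsq : (Real.exp (-(9 * Real.sqrt ((2 * K : ℕ) : ℝ))) * hexConnectiveConstant ^ (2 * K)) ^ 2 =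
      Real.exp (-(18 * Real.sqrt ((2 * K : ℕ) : ℝ))) * hexConnectiveConstant ^ (4 * K) := by
    rw [mul_pow, ← Real.exp_nat_mul, ← pow_mul]
    congr 1
    · congr 1; push_cast; ring
    · congr 1; ring
  rw [hsq] at he
  -- the exponent comparison: `-(p+30)√N + 23 ≤ -18√(2K) - p√K`
  have h18 : 18 * Real.sqrt ((2 * K : ℕ) : ℝ) ≤ 26 * Real.sqrt (K : ℝ) := by
    have := eighteen_sqrt_two_mul_le (K : ℝ) (by positivity)
    push_cast
    exact this
  have hexpcmp : -((p + 30) * Real.sqrt (N : ℝ)) + 23 + p * Real.sqrt (K : ℝ) ≤ -(18 * Real.sqrt ((2 * K : ℕ) : ℝ)) := by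
    nlinarith [hsN, hsK, h18, hp]
  -- `μ^N ≤ μ^{4K} e^{23}`
  have hμN : hexConnectiveConstant ^ N ≤ hexConnectiveConstant ^ (4 * K) * Real.exp 23 := by
    obtain ⟨j, hj, rfl⟩ : ∃ j, j ≤ 23 ∧ N = 4 * K + j := ⟨N - 4 * K, by omega, by omega⟩
    rw [pow_add]
    exact mul_le_mul_of_nonneg_left (hexMu_pow_le_exp hj) (by positivity)
  -- assemble
  have hE0 : 0 < Real.exp (p * Real.sqrt (K : ℝ)) := Real.exp_pos _
  have step : Real.exp (-((p + 30) * Real.sqrt (N : ℝ))) * hexConnectiveConstant ^ N * Real.exp (p * Real.sqrt (K : ℝ)) ≤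
      Real.exp (-(18 * Real.sqrt ((2 * K : ℕ) : ℝ))) * hexConnectiveConstant ^ (4 * K) := by
    calc Real.exp (-((p + 30) * Real.sqrt (N : ℝ))) * hexConnectiveConstant ^ N * Real.exp (p * Real.sqrt (K : ℝ))
        ≤ Real.exp (-((p + 30) * Real.sqrt (N : ℝ))) * (hexConnectiveConstant ^ (4 * K) * Real.exp 23) *
            Real.exp (p * Real.sqrt (K : ℝ)) := by gcongr
      _ = Real.exp (-((p + 30) * Real.sqrt (N : ℝ)) + 23 + p * Real.sqrt (K : ℝ)) * hexConnectiveConstant ^ (4 * K) := by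
          rw [Real.exp_add, Real.exp_add]; ring
      _ ≤ Real.exp (-(18 * Real.sqrt ((2 * K : ℕ) : ℝ))) * hexConnectiveConstant ^ (4 * K) :=
          mul_le_mul_of_nonneg_right (Real.exp_le_exp.2 hexpcmp) (by positivity)
  have := step.trans he
  -- cancel `exp (p√K)`
  rw [mul_comm (Real.exp (p * Real.sqrt (K : ℝ))) e] at this
  exact le_of_mul_le_mul_right this hE0

/-- `d · K^k ≤ e^{(log d + 2k) √K}` for `d ≥ 1`, `K ≥ 1` (`log K ≤ 2 √K`). [folklore] -/
private theorem poly_le_exp_sqrt {d : ℝ} {k K : ℕ} (hd : 1 ≤ d) (hK : 1 ≤ K) :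
    d * (K : ℝ) ^ k ≤ Real.exp ((Real.log d + 2 * k) * Real.sqrt (K : ℝ)) := by
  have hKr : (1 : ℝ) ≤ K := by exact_mod_cast hK
  have hK0 : (0 : ℝ) < K := by linarith
  have hsK : 1 ≤ Real.sqrt (K : ℝ) := by
    rw [Real.le_sqrt (by norm_num) (by positivity)]; simpa using hKr
  have hlogd : 0 ≤ Real.log d := Real.log_nonneg hd
  -- `log K ≤ 2 √K`
  have hlogK : Real.log (K : ℝ) ≤ 2 * Real.sqrt (K : ℝ) := by
    have h1 : Real.log (Real.sqrt (K : ℝ)) ≤ Real.sqrt (K : ℝ) - 1 :=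
      Real.log_le_sub_one_of_pos (by positivity)
    have h2 : Real.log (K : ℝ) = 2 * Real.log (Real.sqrt (K : ℝ)) := by
      rw [Real.log_sqrt hK0.le]; ring
    rw [h2]; linarith
  have hrhs : d * (K : ℝ) ^ k = Real.exp (Real.log d + k * Real.log (K : ℝ)) := by
    rw [Real.exp_add, Real.exp_log (by linarith), ← Real.log_pow, Real.exp_log (by positivity)]
  rw [hrhs]
  apply Real.exp_le_exp.2
  have hk0 : (0 : ℝ) ≤ k := Nat.cast_nonneg _
  nlinarith [hlogK, hsK, hlogd, hk0]

/-- **The endpoint envelope at `nb2` from the HEX-SAP pair bound**: `HexSAPPairBound P`, `P(K) ≤ d·K^k` (`d ≥ 1`) ⇒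
`HexEndpointLo nb2 (log d + 2k + 30) 1` (all `m ≥ 13`). [cite: MadrasSlade1993, Theorem 3.2.4, Corollary 3.2.6] -/
theorem hexEndpointLo_nb2_of_pairBound {P : ℕ → ℕ} {d : ℝ} {k : ℕ} (hd : 1 ≤ d)
    (hP : ∀ K : ℕ, 1 ≤ K → (P K : ℝ) ≤ d * (K : ℝ) ^ k) (h : HexSAPPairBound P) :
    HexEndpointLo nb2 (Real.log d + 2 * k + 30) 1 := by
  have hμ := hexConnectiveConstant_pos
  refine ⟨13, fun m hm => ?_⟩
  -- write `2m+1 = 4K+21` (m even) or `4K+23` (m odd), `K ≥ 1`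
  obtain ⟨K, hK, hKm⟩ : ∃ K : ℕ, 1 ≤ K ∧ (2 * m + 1 = 4 * K + 21 ∨ 2 * m + 1 = 4 * K + 23) := by
    rcases Nat.even_or_odd m with ⟨j, hj⟩ | ⟨j, hj⟩
    · exact ⟨j - 5, by omega, Or.inl (by omega)⟩
    · exact ⟨j - 5, by omega, Or.inr (by omega)⟩
  set N := 2 * m + 1 with hN
  have hN1 : 4 * K + 21 ≤ N := by omega
  have hN2 : N ≤ 4 * K + 23 := by omega
  obtain ⟨h21, h23⟩ := h K hK
  -- the count at `N`, in brick-wall form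
  have hcount : HexBW.bridgeCount (2 * K) ^ 2 ≤ P K * #(endFin nb2 N) := by
    rw [card_endFin_eq_card_bw, hvToBW_nb2]
    rcases hKm with e | e
    · rw [e]; exact h21
    · rw [e]; exact h23
  have hcountR : ((HexBW.bridgeCount (2 * K) : ℝ)) ^ 2 ≤ (P K : ℝ) * #(endFin nb2 N) := by exact_mod_cast hcount
  -- positivity of `P K`: from the bridge envelope `b_{2K} > 0`
  have hb := hexBridgeLo (2 * K)
  have hbpos : (0 : ℝ) < HexBW.bridgeCount (2 * K) := lt_of_lt_of_le (by positivity) hb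
  have hP0 : (0 : ℝ) < P K := by
    by_contra hle
    push Not at hle
    have : (P K : ℝ) * #(endFin nb2 N) ≤ 0 := mul_nonpos_of_nonpos_of_nonneg hle (Nat.cast_nonneg _)
    nlinarith
  have hp : 0 ≤ Real.log d + 2 * k := by
    have := Real.log_nonneg hd; positivity
  have hPexp : (P K : ℝ) ≤ Real.exp ((Real.log d + 2 * k) * Real.sqrt (K : ℝ)) := (hP K hK).trans (poly_le_exp_sqrt hd hK)
  have key := pairBound_core (e := (#(endFin nb2 N) : ℝ)) hK hp hN1 hN2 hb hP0 hPexp hcountR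
  simpa only [show Real.log d + 2 * k + 30 = (Real.log d + 2 * k) + 30 by ring] using key

/-- **The endpoint envelope at EVERY neighbour of the origin** (by the rotation `rot3`). [cite: MadrasSlade1993, Corollary 3.2.6] -/
theorem hexEndpointLo_of_pairBound {P : ℕ → ℕ} {d : ℝ} {k : ℕ} (hd : 1 ≤ d)
    (hP : ∀ K : ℕ, 1 ≤ K → (P K : ℝ) ≤ d * (K : ℝ) ^ k) (h : HexSAPPairBound P) {z : HV} (hz : hvGraph.Adj hvOrigin z) :
    HexEndpointLo z (Real.log d + 2 * k + 30) 1 := by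
  have h2 := hexEndpointLo_nb2_of_pairBound hd hP h
  rcases (adj_hvOrigin_iff z).1 hz with rfl | rfl | rfl
  · exact hexEndpointLo_congr (fun N => (card_endFin_nb2 N).symm) h2
  · exact hexEndpointLo_congr (fun N => (card_endFin_nb1 N).trans (card_endFin_nb2 N).symm) h2
  · exact h2

/-- **The polygon envelope from the HEX-SAP pair bound**: `HexAdjEndLo (log d + 2k + 30)` (`#A_N = 3·#E_N(nb0) ≥ #E_N(nb0)`).
[cite: MadrasSlade1993, Theorem 3.2.3 / (3.2.5)] -/
theorem hexAdjEndLo_of_pairBound {P : ℕ → ℕ} {d : ℝ} {k : ℕ} (hd : 1 ≤ d)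
    (hP : ∀ K : ℕ, 1 ≤ K → (P K : ℝ) ≤ d * (K : ℝ) ^ k) (h : HexSAPPairBound P) :
    HexAdjEndLo (Real.log d + 2 * k + 30) := by
  have hnb0 : hvGraph.Adj hvOrigin nb0 := (adj_hvOrigin_iff nb0).2 (Or.inl rfl)
  obtain ⟨m₀, hm₀⟩ := hexEndpointLo_of_pairBound hd hP h hnb0
  refine ⟨m₀, fun m hm => (hm₀ m hm).trans ?_⟩
  have : #(endFin nb0 (2 * m + 1)) ≤ #(adjEndFin (2 * m + 1)) := by rw [card_adjEndFin]; omega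
  exact_mod_cast this

end PairBound

/-! ### The polygon two-step ratio, conditional only on the HEX-SAP pair bound -/

section Ratio

/-- **Theorem 7.3.4 (c) on `ℍ`, per neighbour, modulo the HEX-SAP pair bound**: for each neighbour `z` of the origin,
`#E_{2m+3}(z)/#E_{2m+1}(z) → 2 + √2`.
[cite: MadrasSlade1993, Theorem 7.3.4 (b)(c) (p. 248) and its proof (Lemma 7.3.1 p. 242, Cor 3.2.6 p. 68, Thm 7.3.2 (c) p. 244, Lemma 7.3.3 p. 247, (3.2.1) p. 63)]
[cite: Kesten1963SAW, §4] [cite: DuminilCopinSmirnov2012, Theorem 1] -/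
theorem hexPolygonRatioTwo_of_pairBound {P : ℕ → ℕ} {d : ℝ} {k : ℕ} (hd : 1 ≤ d)
    (hP : ∀ K : ℕ, 1 ≤ K → (P K : ℝ) ≤ d * (K : ℝ) ^ k) (h : HexSAPPairBound P) {z : HV} (hz : hvGraph.Adj hvOrigin z) :
    Tendsto (fun m : ℕ => (#(endFin z (2 * m + 1 + 2)) : ℝ) / #(endFin z (2 * m + 1))) atTop (𝓝 (2 + Real.sqrt 2)) := by
  have hc : 0 ≤ Real.log d + 2 * k + 30 := by have := Real.log_nonneg hd; positivity
  exact hexPolygonRatioTwo_of hc (hexAdjEndLo_of_pairBound hd hP h) hz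

/-- **Theorem 7.3.4 (c) on `ℍ` modulo the HEX-SAP pair bound**: `#A_{2m+3}/#A_{2m+1} → 2 + √2` — rooted polygons through the origin,
lengths `2m+4` over `2m+2`; i.e. `p_{n+2}(ℍ)/p_n(ℍ) → μ_ℍ² = 2 + √2` along even `n`.
[cite: MadrasSlade1993, Theorem 7.3.4 (b)(c) (p. 248) and its proof (Lemma 7.3.1 p. 242, Cor 3.2.6 p. 68, Thm 7.3.2 (c) p. 244, Lemma 7.3.3 p. 247, (3.2.1) p. 63)]
[cite: Kesten1963SAW, §4] [cite: DuminilCopinSmirnov2012, Theorem 1] -/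
theorem hexAdjEndRatioTwo_of_pairBound {P : ℕ → ℕ} {d : ℝ} {k : ℕ} (hd : 1 ≤ d)
    (hP : ∀ K : ℕ, 1 ≤ K → (P K : ℝ) ≤ d * (K : ℝ) ^ k) (h : HexSAPPairBound P) :
    Tendsto (fun m : ℕ => (#(adjEndFin (2 * m + 1 + 2)) : ℝ) / #(adjEndFin (2 * m + 1))) atTop (𝓝 (2 + Real.sqrt 2)) := by
  have hc : 0 ≤ Real.log d + 2 * k + 30 := by have := Real.log_nonneg hd; positivity
  exact hexAdjEndRatioTwo_of hc (hexAdjEndLo_of_pairBound hd hP h)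

end Ratio

end Literature.Probability.RandomPlanarGeometry.SAW.HV

end
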